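import Mathlib
import HarnessLib
import Literature.Probability.MarkovChains.MetropolisHastings
import Summits.Ventures.LatticeQCDFlow.Exactness.JarzynskiFinite
import Summits.Ventures.LatticeQCDFlow.Exactness.TemperedTransitions
import Summits.Ventures.LatticeQCDFlow.Exactness.CrooksReversal
import Summits.Ventures.LatticeQCDFlow.Exactness.BennettAcceptanceRatio

/-!
# Bennett's optimal weighting function: the Fermi function of the work minimises the two-sample variance

HONEST FRAMING: exact (Metropolis-corrected) sampling algorithms for lattice gauge theory;
figures of merit are autocorrelation/cost numbers at stated couplings and volumes; no
continuum-physics claim.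

Venture `LatticeQCDFlow` (cell pub-lqcd), topic `Exactness`; FANOUT row 13 (`eng-snf`: the
`latflow-snf` protocol engine — `snf.estimators.bar`, `snf.twosided`, `snf.protocol.run_forward /
run_reverse`).  NEW WORK of the cell (elementary finite sums: a weighted Cauchy–Schwarz inequality
with its equality case); the printed counterpart is named only, nothing is cited as a fact:
C. H. Bennett, J. Comput. Phys. 22 (1976) 245, eqs. (6)–(12).  `BennettAcceptanceRatio.lean` calls
`fermiWeight` "Bennett's optimal weighting function" in a docstring; this file PROVES the optimality.

## Content

TWO-LAW SETTING.  A finite set `Y` ("paths"), a forward law `p`, a reverse law `q ≥ 0`, a work function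
`W` and a number `dF` tied by the pointwise Crooks relation `p y · e^{-W y} = e^{-dF} · q y`.  For ANY
statistic `α : Y → ℝ` the two-sample estimator of `e^{-dF}` is `mean_fwd (α e^{-W}) / mean_rev (α)`
(population identity `E_p[α e^{-W}] = e^{-dF} E_q[α]`, `twoSample_identity`); its leading-order relative
variance with `nf` forward and `nr` reverse samples (delta method; Bennett's eq. (7)) is the functional
`bennettVar nf nr p q W α = (E_p[(α e^{-W})²]/E_p[α e^{-W}]² − 1)/nf + (E_q[α²]/E_q[α]² − 1)/nr`.
* `bennettVar_eq_of_crooks` — Bennett's substitution: the functional equals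
  `Σ_y q g α² / (Σ_y q α)² − 1/nf − 1/nr` with `g y = e^{dF − W y}/nf + 1/nr`.
* `sq_sum_le_overlap_mul` / `sq_sum_eq_overlap_mul_iff` — weighted Cauchy–Schwarz
  `(Σ q α)² ≤ (Σ q g α²)(Σ q/g)` from the completed square (`overlap_mul_sub_sq_eq`), with the equality
  case `α = c/g` on the support of `q`.
* `bennettVar_ge` — **lower bound**: for every `α` with `E_q[α] ≠ 0`,
  `1 / bennettOverlap − 1/nf − 1/nr ≤ bennettVar … α`, `bennettOverlap nf nr q W dF = Σ_y q y / g y`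
  (Bennett's overlap sum, his eq. (11) in the work form).
* `bennettVar_bennettWeight` — **attained** by the Fermi function of the shifted work,
  `bennettWeight nf nr W dF y = fermiWeight (−(M + W y − dF))`, `M = log (nf/nr)` — the weight whose
  population equation is `bennett_population` (`BennettAcceptanceRatio.lean`) and whose sample equation
  `snf.estimators.bar` solves (`barFn_existsUnique_root`).
* `bennettVar_eq_bound_iff` — **uniqueness**: the bound is attained iff `α` is a constant multiple of
  `bennettWeight` on the support of `q`: no statistic OF THE WHOLE PATH beats the Fermi function OF THE
  WORK ALONE.
PATH SETTING (objects of `CrooksReversal.lean`: kernels `P k`, adjoint kernels `Padj k`, forward path law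
`pathLaw (gibbsLaw (S 0)) P`, reverse path law `gibbsLaw (S n) (x n) · downProb Padj x`,
`ΔF = freeEnergy (S n) − freeEnergy (S 0)`): `crooks_pointwise_law` (normalised pointwise Crooks),
`bennett_optimal_weight` / `bennett_optimal_weight_attained` — Bennett's acceptance ratio (latflow-snf
`estimators.bar` / `twosided`) is the minimum-variance member of the whole two-sample family, for any
protocol length, any adjoint pair of kernels, any sample sizes.  NOT formalised: the delta-method step
from the estimator to the functional (the functional is the object, as in Bennett's paper) and
finite-sample / autocorrelation corrections.
-/

namespace Summit.Ventures.LatticeQCDFlow.Exactness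

open Finset
open Literature.Probability.MarkovChains

/-! ## The two-law setting -/

section TwoLaw

variable {Y : Type*} [Fintype Y]

/-- Bennett's two-sample variance functional (leading-order relative variance of
`mean_fwd (α e^{-W}) / mean_rev α` with `nf` forward and `nr` reverse samples):
`(E_p[(α e^{-W})²] / E_p[α e^{-W}]² − 1) / nf + (E_q[α²] / E_q[α]² − 1) / nr`. -/
noncomputable def bennettVar (nf nr : ℝ) (p q W α : Y → ℝ) : ℝ :=
  ((∑ y, p y * (α y * Real.exp (-W y)) ^ 2) / (∑ y, p y * (α y * Real.exp (-W y))) ^ 2 - 1) / nf +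
    ((∑ y, q y * α y ^ 2) / (∑ y, q y * α y) ^ 2 - 1) / nr

/-- Bennett's overlap sum `Σ_y q y / (e^{dF − W y} / nf + 1 / nr)` (eq. (11) of Bennett 1976 in the
work form). -/
noncomputable def bennettOverlap (nf nr : ℝ) (q W : Y → ℝ) (dF : ℝ) : ℝ :=
  ∑ y, q y / (Real.exp (dF - W y) / nf + 1 / nr)

/-- Bennett's weighting function: the Fermi function of the shifted work,
`fermiWeight (−(log (nf/nr) + W y − dF)) = 1 / (1 + (nr/nf) e^{dF − W y})`. -/
noncomputable def bennettWeight (nf nr : ℝ) (W : Y → ℝ) (dF : ℝ) (y : Y) : ℝ :=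
  fermiWeight (-(Real.log (nf / nr) + W y - dF))

/-- The two-sample population identity behind every acceptance-ratio estimator: under the pointwise
Crooks relation, `E_p[α e^{-W}] = e^{-dF} · E_q[α]` for EVERY statistic `α`. -/
theorem twoSample_identity (p q W α : Y → ℝ) (dF : ℝ)
    (hcrooks : ∀ y, p y * Real.exp (-W y) = Real.exp (-dF) * q y) :
    ∑ y, p y * (α y * Real.exp (-W y)) = Real.exp (-dF) * ∑ y, q y * α y := by
  rw [mul_sum]
  refine sum_congr rfl fun y _ => ?_
  rw [show p y * (α y * Real.exp (-W y)) = (p y * Real.exp (-W y)) * α y by ring, hcrooks y]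
  ring

/-- **Bennett's substitution.**  Under the pointwise Crooks relation the variance functional is
`Σ_y q α² (e^{dF−W}/nf + 1/nr) / (Σ_y q α)² − 1/nf − 1/nr`. -/
theorem bennettVar_eq_of_crooks (nf nr : ℝ) (p q W α : Y → ℝ) (dF : ℝ)
    (hcrooks : ∀ y, p y * Real.exp (-W y) = Real.exp (-dF) * q y) :
    bennettVar nf nr p q W α =
      (∑ y, q y * (Real.exp (dF - W y) / nf + 1 / nr) * α y ^ 2) / (∑ y, q y * α y) ^ 2
        - 1 / nf - 1 / nr := by
  set u := Real.exp (-dF) with hu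
  have hu0 : u ≠ 0 := Real.exp_ne_zero _
  have hexp : ∀ y, Real.exp (dF - W y) = u⁻¹ * Real.exp (-W y) := fun y => by
    rw [hu, ← Real.exp_neg, neg_neg, ← Real.exp_add]; ring_nf
  set A := ∑ y, q y * α y with hA
  set B := ∑ y, q y * α y ^ 2 * Real.exp (-W y) with hB
  set C := ∑ y, q y * α y ^ 2 with hC
  have h1 : ∑ y, p y * (α y * Real.exp (-W y)) = u * A := twoSample_identity p q W α dF hcrooks
  have h2 : ∑ y, p y * (α y * Real.exp (-W y)) ^ 2 = u * B := by
    rw [hB, mul_sum]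
    refine sum_congr rfl fun y _ => ?_
    rw [show p y * (α y * Real.exp (-W y)) ^ 2 = (p y * Real.exp (-W y)) * (α y ^ 2 * Real.exp (-W y))
      by ring, hcrooks y]
    ring
  have h3 : ∑ y, q y * (Real.exp (dF - W y) / nf + 1 / nr) * α y ^ 2 = u⁻¹ * B / nf + C / nr := by
    rw [hB, hC, mul_sum, sum_div, sum_div, ← sum_add_distrib]
    exact sum_congr rfl fun y _ => by rw [hexp y]; ring
  unfold bennettVar
  rw [h1, h2, h3, ← hC, ← hA]
  field_simp
  ring

/-- The completed-square identity behind the weighted Cauchy–Schwarz inequality: for `0 < g`,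
`(Σ q g α²)(Σ q/g) − (Σ q α)² = (Σ q/g) · Σ_y q g (α − c/g)²` with `c = (Σ q α)/(Σ q/g)`,
provided `Σ q/g ≠ 0`. -/
theorem overlap_mul_sub_sq_eq (q g α : Y → ℝ) (hg : ∀ y, 0 < g y)
    (hG : ∑ y, q y / g y ≠ 0) :
    (∑ y, q y * g y * α y ^ 2) * (∑ y, q y / g y) - (∑ y, q y * α y) ^ 2 =
      (∑ y, q y / g y) *
        ∑ y, q y * g y * (α y - (∑ z, q z * α z) / (∑ z, q z / g z) / g y) ^ 2 := by
  set A := ∑ y, q y * α y with hA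
  set G := ∑ y, q y / g y with hG'
  set X := ∑ y, q y * g y * α y ^ 2 with hX
  have hexpand : ∀ y, q y * g y * (α y - A / G / g y) ^ 2 =
      q y * g y * α y ^ 2 - 2 * (A / G) * (q y * α y) + (A / G) ^ 2 * (q y / g y) := fun y => by
    have hgy : g y ≠ 0 := (hg y).ne'
    field_simp
    ring
  simp_rw [hexpand]
  rw [sum_add_distrib, sum_sub_distrib, ← mul_sum, ← mul_sum, ← hX, ← hA, ← hG']
  field_simp
  ring

/-- **Weighted Cauchy–Schwarz.**  For `q ≥ 0`, `g > 0` (and `Σ q/g ≠ 0`, else `q = 0`):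
`(Σ q α)² ≤ (Σ q g α²) · (Σ q/g)`. -/
theorem sq_sum_le_overlap_mul (q g α : Y → ℝ) (hq : ∀ y, 0 ≤ q y) (hg : ∀ y, 0 < g y)
    (hG : ∑ y, q y / g y ≠ 0) :
    (∑ y, q y * α y) ^ 2 ≤ (∑ y, q y * g y * α y ^ 2) * (∑ y, q y / g y) := by
  have hGpos : 0 < ∑ y, q y / g y :=
    lt_of_le_of_ne (sum_nonneg fun z _ => div_nonneg (hq z) (hg z).le) (Ne.symm hG)
  have key := overlap_mul_sub_sq_eq q g α hg hG
  have hsq : 0 ≤ ∑ y, q y * g y * (α y - (∑ z, q z * α z) / (∑ z, q z / g z) / g y) ^ 2 :=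
    sum_nonneg fun y _ => mul_nonneg (mul_nonneg (hq y) (hg y).le) (sq_nonneg _)
  nlinarith [mul_nonneg hGpos.le hsq]

/-- Equality case of the weighted Cauchy–Schwarz inequality: for `q ≥ 0`, `g > 0` and
`Σ q/g ≠ 0`, equality holds iff `α y = c / g y` on the support of `q`, with
`c = (Σ q α)/(Σ q/g)`. -/
theorem sq_sum_eq_overlap_mul_iff (q g α : Y → ℝ) (hq : ∀ y, 0 ≤ q y) (hg : ∀ y, 0 < g y)
    (hG : ∑ y, q y / g y ≠ 0) :
    (∑ y, q y * α y) ^ 2 = (∑ y, q y * g y * α y ^ 2) * (∑ y, q y / g y) ↔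
      ∀ y, q y ≠ 0 → α y = (∑ z, q z * α z) / (∑ z, q z / g z) / g y := by
  have key := overlap_mul_sub_sq_eq q g α hg hG
  set c := (∑ z, q z * α z) / (∑ z, q z / g z) with hc
  have hterm_nn : ∀ y, 0 ≤ q y * g y * (α y - c / g y) ^ 2 :=
    fun y => mul_nonneg (mul_nonneg (hq y) (hg y).le) (sq_nonneg _)
  constructor
  · intro heq y hqy
    have hS : (∑ y, q y / g y) * ∑ y, q y * g y * (α y - c / g y) ^ 2 = 0 := by
      rw [← key, ← heq, sub_self]
    have hS' : ∑ y, q y * g y * (α y - c / g y) ^ 2 = 0 := by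
      rcases mul_eq_zero.mp hS with h | h
      · exact absurd h hG
      · exact h
    have hy := (sum_eq_zero_iff_of_nonneg fun z _ => hterm_nn z).mp hS' y (mem_univ y)
    rcases mul_eq_zero.mp hy with h | h
    · rcases mul_eq_zero.mp h with h' | h'
      · exact absurd h' hqy
      · exact absurd h' (hg y).ne'
    · have : α y - c / g y = 0 := pow_eq_zero_iff (two_ne_zero) |>.mp h
      linarith
  · intro hα
    have hS' : ∑ y, q y * g y * (α y - c / g y) ^ 2 = 0 := by
      refine sum_eq_zero fun y _ => ?_
      by_cases hqy : q y = 0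
      · simp [hqy]
      · rw [hα y hqy, sub_self]; ring
    have := key
    rw [hS', mul_zero, sub_eq_zero] at this
    exact this.symm

variable {nf nr : ℝ}

omit [Fintype Y] in
/-- The Bennett weight is `(1/nr) / (e^{dF − W y}/nf + 1/nr)`: a constant over Bennett's `g`. -/
theorem bennettWeight_eq (hnf : 0 < nf) (hnr : 0 < nr) (W : Y → ℝ) (dF : ℝ) (y : Y) :
    bennettWeight nf nr W dF y = (1 / nr) / (Real.exp (dF - W y) / nf + 1 / nr) := by
  unfold bennettWeight fermiWeight
  have hratio : 0 < nf / nr := div_pos hnf hnr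
  have hexp : Real.exp (-(Real.log (nf / nr) + W y - dF)) = (nr / nf) * Real.exp (dF - W y) := by
    rw [show -(Real.log (nf / nr) + W y - dF) = -Real.log (nf / nr) + (dF - W y) by ring,
      Real.exp_add, Real.exp_neg, Real.exp_log hratio, inv_div]
  rw [hexp]
  have hnf0 : nf ≠ 0 := hnf.ne'
  have hnr0 : nr ≠ 0 := hnr.ne'
  have hpos : 0 < Real.exp (dF - W y) := Real.exp_pos _
  field_simp
  ring

omit [Fintype Y] in
/-- Bennett's `g y = e^{dF − W y}/nf + 1/nr` is positive. -/
theorem bennett_g_pos (hnf : 0 < nf) (hnr : 0 < nr) (W : Y → ℝ) (dF : ℝ) (y : Y) :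
    0 < Real.exp (dF - W y) / nf + 1 / nr :=
  add_pos (div_pos (Real.exp_pos _) hnf) (div_pos one_pos hnr)

/-- The overlap sum is positive as soon as `q ≥ 0` has a non-zero mean of SOME statistic. -/
theorem bennettOverlap_pos (hnf : 0 < nf) (hnr : 0 < nr) (q W α : Y → ℝ) (dF : ℝ)
    (hq : ∀ y, 0 ≤ q y) (hA : ∑ y, q y * α y ≠ 0) :
    0 < bennettOverlap nf nr q W dF := by
  unfold bennettOverlap
  obtain ⟨y₀, -, hy₀⟩ : ∃ y ∈ (univ : Finset Y), q y * α y ≠ 0 := by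
    by_contra h
    push Not at h
    exact hA (sum_eq_zero h)
  have hq₀ : 0 < q y₀ := lt_of_le_of_ne (hq y₀) (fun h => hy₀ (by rw [← h, zero_mul]))
  exact sum_pos' (fun z _ => div_nonneg (hq z) (bennett_g_pos hnf hnr W dF z).le)
    ⟨y₀, mem_univ _, div_pos hq₀ (bennett_g_pos hnf hnr W dF y₀)⟩

/-- **Bennett's lower bound.**  Under the pointwise Crooks relation, for EVERY statistic `α` with
`E_q[α] ≠ 0`: `1 / bennettOverlap − 1/nf − 1/nr ≤ bennettVar nf nr p q W α`. -/
theorem bennettVar_ge (hnf : 0 < nf) (hnr : 0 < nr) (p q W α : Y → ℝ) (dF : ℝ)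
    (hcrooks : ∀ y, p y * Real.exp (-W y) = Real.exp (-dF) * q y) (hq : ∀ y, 0 ≤ q y)
    (hA : ∑ y, q y * α y ≠ 0) :
    1 / bennettOverlap nf nr q W dF - 1 / nf - 1 / nr ≤ bennettVar nf nr p q W α := by
  rw [bennettVar_eq_of_crooks nf nr p q W α dF hcrooks]
  have hG : 0 < bennettOverlap nf nr q W dF := bennettOverlap_pos hnf hnr q W α dF hq hA
  have hA2 : 0 < (∑ y, q y * α y) ^ 2 := by positivity
  have hcs := sq_sum_le_overlap_mul q (fun y => Real.exp (dF - W y) / nf + 1 / nr) α hq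
    (bennett_g_pos hnf hnr W dF) hG.ne'
  have hle : 1 / bennettOverlap nf nr q W dF ≤
      (∑ y, q y * (Real.exp (dF - W y) / nf + 1 / nr) * α y ^ 2) / (∑ y, q y * α y) ^ 2 := by
    rw [div_le_div_iff₀ hG hA2, one_mul]
    simpa [bennettOverlap] using hcs
  linarith

/-- The variance functional at a constant multiple of `1/g`: `c/g` attains `1/overlap − 1/nf − 1/nr`
(for `c ≠ 0` and a non-degenerate `q`). -/
theorem bennettVar_const_div_g (hnf : 0 < nf) (hnr : 0 < nr) (p q W : Y → ℝ) (dF c : ℝ)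
    (hcrooks : ∀ y, p y * Real.exp (-W y) = Real.exp (-dF) * q y)
    (hc : c ≠ 0) (hG : bennettOverlap nf nr q W dF ≠ 0) :
    bennettVar nf nr p q W (fun y => c / (Real.exp (dF - W y) / nf + 1 / nr)) =
      1 / bennettOverlap nf nr q W dF - 1 / nf - 1 / nr := by
  rw [bennettVar_eq_of_crooks nf nr p q W _ dF hcrooks]
  have hnum : ∑ y, q y * (Real.exp (dF - W y) / nf + 1 / nr) *
      (c / (Real.exp (dF - W y) / nf + 1 / nr)) ^ 2 = c ^ 2 * bennettOverlap nf nr q W dF := by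
    unfold bennettOverlap; rw [mul_sum]; refine sum_congr rfl fun y _ => ?_
    have hgy : Real.exp (dF - W y) / nf + 1 / nr ≠ 0 := (bennett_g_pos hnf hnr W dF y).ne'
    field_simp
  have hden : ∑ y, q y * (c / (Real.exp (dF - W y) / nf + 1 / nr)) =
      c * bennettOverlap nf nr q W dF := by
    unfold bennettOverlap; rw [mul_sum]; exact sum_congr rfl fun y _ => by ring
  rw [hnum, hden]
  field_simp

/-- **The bound is attained by Bennett's weight** (the Fermi function of the shifted work). -/
theorem bennettVar_bennettWeight (hnf : 0 < nf) (hnr : 0 < nr) (p q W : Y → ℝ) (dF : ℝ)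
    (hcrooks : ∀ y, p y * Real.exp (-W y) = Real.exp (-dF) * q y)
    (hG : bennettOverlap nf nr q W dF ≠ 0) :
    bennettVar nf nr p q W (bennettWeight nf nr W dF) =
      1 / bennettOverlap nf nr q W dF - 1 / nf - 1 / nr := by
  rw [show bennettWeight nf nr W dF = fun y => (1 / nr) / (Real.exp (dF - W y) / nf + 1 / nr) from
    funext fun y => bennettWeight_eq hnf hnr W dF y]
  exact bennettVar_const_div_g hnf hnr p q W dF (1 / nr) hcrooks (by positivity) hG

/-- **Uniqueness of the optimum.**  For a statistic `α` with `E_q[α] ≠ 0` the bound is attained iff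
`α` is a constant multiple of Bennett's weight on the support of `q`. -/
theorem bennettVar_eq_bound_iff (hnf : 0 < nf) (hnr : 0 < nr) (p q W α : Y → ℝ) (dF : ℝ)
    (hcrooks : ∀ y, p y * Real.exp (-W y) = Real.exp (-dF) * q y) (hq : ∀ y, 0 ≤ q y)
    (hA : ∑ y, q y * α y ≠ 0) :
    bennettVar nf nr p q W α = 1 / bennettOverlap nf nr q W dF - 1 / nf - 1 / nr ↔
      ∃ c : ℝ, ∀ y, q y ≠ 0 → α y = c * bennettWeight nf nr W dF y := by
  set g : Y → ℝ := fun y => Real.exp (dF - W y) / nf + 1 / nr with hgdef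
  have hgpos : ∀ y, 0 < g y := bennett_g_pos hnf hnr W dF
  have hG : 0 < bennettOverlap nf nr q W dF := bennettOverlap_pos hnf hnr q W α dF hq hA
  have hGsum : ∑ y, q y / g y = bennettOverlap nf nr q W dF := rfl
  have hA2 : 0 < (∑ y, q y * α y) ^ 2 := by positivity
  have hw : ∀ y, bennettWeight nf nr W dF y = (1 / nr) / g y := bennettWeight_eq hnf hnr W dF
  rw [bennettVar_eq_of_crooks nf nr p q W α dF hcrooks]
  constructor
  · intro heq
    have heq' : (∑ y, q y * g y * α y ^ 2) / (∑ y, q y * α y) ^ 2 =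
        1 / bennettOverlap nf nr q W dF := by
      have := heq; simp only [hgdef] at this ⊢; linarith
    have hsq : (∑ y, q y * α y) ^ 2 = (∑ y, q y * g y * α y ^ 2) * (∑ y, q y / g y) := by
      rw [hGsum]
      rw [div_eq_div_iff hA2.ne' hG.ne', one_mul] at heq'
      linarith
    have hcase := (sq_sum_eq_overlap_mul_iff q g α hq hgpos (by rw [hGsum]; exact hG.ne')).mp hsq
    refine ⟨(∑ z, q z * α z) / (∑ z, q z / g z) * nr, fun y hqy => ?_⟩
    rw [hcase y hqy, hw y]
    have hgy : g y ≠ 0 := (hgpos y).ne'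
    field_simp
  · rintro ⟨c, hc⟩
    have hc0 : c ≠ 0 := by
      rintro rfl
      apply hA
      refine sum_eq_zero fun y _ => ?_
      by_cases hqy : q y = 0
      · simp [hqy]
      · rw [hc y hqy]; ring
    -- replace α by c · bennettWeight = (c/nr)/g inside the q-weighted sums
    have hpt : ∀ y, q y = 0 ∨ α y = c / nr / g y := fun y => (eq_or_ne (q y) 0).imp_right fun hqy => by
      rw [hc y hqy, hw y, hgdef]; have hgy : g y ≠ 0 := (hgpos y).ne'; field_simp
    have hnum : ∑ y, q y * g y * α y ^ 2 = ∑ y, q y * g y * (c / nr / g y) ^ 2 :=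
      sum_congr rfl fun y _ => by rcases hpt y with h | h <;> simp [h]
    have hden : ∑ y, q y * α y = ∑ y, q y * (c / nr / g y) :=
      sum_congr rfl fun y _ => by rcases hpt y with h | h <;> simp [h]
    have hmain := bennettVar_const_div_g hnf hnr p q W dF (c / nr) hcrooks
      (div_ne_zero hc0 hnr.ne') hG.ne'
    rw [bennettVar_eq_of_crooks nf nr p q W _ dF hcrooks] at hmain
    simp only [hgdef] at hnum hden ⊢
    rw [hnum, hden]
    exact hmain

end TwoLaw

/-! ## The path setting: forward protocol versus reverse protocol with adjoint kernels -/

section Paths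

variable {X : Type*} [Fintype X]

/-- **Normalised pointwise Crooks relation.**  With the forward path law `pathLaw (gibbsLaw (S 0)) P`,
the reverse path law `gibbsLaw (S n) (x n) · downProb Padj x` and `ΔF = freeEnergy (S n) − freeEnergy (S 0)`:
`pathLaw_fwd x · e^{-W x} = e^{-ΔF} · revLaw x` for EVERY path `x`. -/
theorem crooks_pointwise_law {n : ℕ} [Nonempty X] (S : Fin (n + 1) → X → ℝ)
    (P Padj : Fin n → X → X → ℝ)
    (hrev : ∀ k : Fin n, MutuallyReversible (fun a => Real.exp (-S k.succ a)) (P k) (Padj k))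
    (x : Fin (n + 1) → X) :
    pathLaw (gibbsLaw (S 0)) P x * Real.exp (-work S x) =
      Real.exp (-(freeEnergy (S (Fin.last n)) - freeEnergy (S 0))) *
        (gibbsLaw (S (Fin.last n)) (x (Fin.last n)) * downProb Padj x) := by
  have hZ0 : 0 < partitionFn (S 0) := sum_pos (fun y _ => Real.exp_pos _) univ_nonempty
  have hZn : 0 < partitionFn (S (Fin.last n)) := sum_pos (fun y _ => Real.exp_pos _) univ_nonempty
  have h := crooks_pathwise S P Padj hrev x
  rw [← partitionFn_div_eq_exp_neg_freeEnergy_sub]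
  simp only [pathLaw, gibbsLaw]
  rw [show Real.exp (-S 0 (x 0)) / partitionFn (S 0) * transProb P x * Real.exp (-work S x) =
      (Real.exp (-S 0 (x 0)) * transProb P x * Real.exp (-work S x)) / partitionFn (S 0) by ring, h]
  field_simp

/-- The reverse path law is non-negative when the adjoint kernels have non-negative entries. -/
theorem reversePathLaw_nonneg {n : ℕ} [Nonempty X] (S : Fin (n + 1) → X → ℝ)
    (Padj : Fin n → X → X → ℝ) (hnn : ∀ k b a, 0 ≤ Padj k b a) (x : Fin (n + 1) → X) :
    0 ≤ gibbsLaw (S (Fin.last n)) (x (Fin.last n)) * downProb Padj x := by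
  have hZ : 0 < partitionFn (S (Fin.last n)) := sum_pos (fun y _ => Real.exp_pos _) univ_nonempty
  exact mul_nonneg (div_nonneg (Real.exp_pos _).le hZ.le) (prod_nonneg fun i _ => hnn _ _ _)

/-- **Bennett's acceptance ratio is the minimum-variance two-sample estimator (path form).**  For a
forward protocol with kernels `P k`, its reverse protocol with adjoint kernels `Padj k` (non-negative
entries), sample sizes `nf, nr > 0` and EVERY statistic `α` of the whole path with non-zero reverse
mean, the two-sample variance functional is at least `1/overlap − 1/nf − 1/nr`. -/
theorem bennett_optimal_weight {n : ℕ} [Nonempty X] (S : Fin (n + 1) → X → ℝ)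
    (P Padj : Fin n → X → X → ℝ)
    (hrev : ∀ k : Fin n, MutuallyReversible (fun a => Real.exp (-S k.succ a)) (P k) (Padj k))
    (hnn : ∀ k b a, 0 ≤ Padj k b a) {nf nr : ℝ} (hnf : 0 < nf) (hnr : 0 < nr)
    (α : (Fin (n + 1) → X) → ℝ)
    (hA : ∑ x : Fin (n + 1) → X,
      gibbsLaw (S (Fin.last n)) (x (Fin.last n)) * downProb Padj x * α x ≠ 0) :
    1 / bennettOverlap nf nr (fun x => gibbsLaw (S (Fin.last n)) (x (Fin.last n)) * downProb Padj x)
          (work S) (freeEnergy (S (Fin.last n)) - freeEnergy (S 0)) - 1 / nf - 1 / nr ≤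
      bennettVar nf nr (pathLaw (gibbsLaw (S 0)) P)
        (fun x => gibbsLaw (S (Fin.last n)) (x (Fin.last n)) * downProb Padj x) (work S) α :=
  bennettVar_ge hnf hnr _ _ _ α _ (crooks_pointwise_law S P Padj hrev)
    (reversePathLaw_nonneg S Padj hnn) hA

/-- **… and the bound is attained by the Fermi function of the work** (`bennettWeight`, shift
`M = log (nf/nr)`): the weight of `bennett_population` / `snf.estimators.bar`. -/
theorem bennett_optimal_weight_attained {n : ℕ} [Nonempty X] (S : Fin (n + 1) → X → ℝ)
    (P Padj : Fin n → X → X → ℝ)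
    (hrev : ∀ k : Fin n, MutuallyReversible (fun a => Real.exp (-S k.succ a)) (P k) (Padj k))
    (hnn : ∀ k b a, 0 ≤ Padj k b a) (hrow : ∀ k b, ∑ a, Padj k b a = 1)
    {nf nr : ℝ} (hnf : 0 < nf) (hnr : 0 < nr) :
    bennettVar nf nr (pathLaw (gibbsLaw (S 0)) P)
        (fun x => gibbsLaw (S (Fin.last n)) (x (Fin.last n)) * downProb Padj x) (work S)
        (bennettWeight nf nr (work S) (freeEnergy (S (Fin.last n)) - freeEnergy (S 0))) =
      1 / bennettOverlap nf nr (fun x => gibbsLaw (S (Fin.last n)) (x (Fin.last n)) * downProb Padj x)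
          (work S) (freeEnergy (S (Fin.last n)) - freeEnergy (S 0)) - 1 / nf - 1 / nr := by
  refine bennettVar_bennettWeight hnf hnr _ _ _ _ (crooks_pointwise_law S P Padj hrev) ?_
  -- the overlap is positive: take α = 1, whose reverse mean is the total mass 1 ≠ 0
  refine (bennettOverlap_pos hnf hnr _ (work S) (fun _ => (1 : ℝ)) _
    (reversePathLaw_nonneg S Padj hnn) ?_).ne'
  simp only [mul_one]
  rw [sum_reversePathLaw S Padj hrow]
  exact one_ne_zero

end Paths

end Summit.Ventures.LatticeQCDFlow.Exactness
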